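import Literature.Computability.AlgebraicComplexity.HomDepthFourSubstUpperBound
import Literature.Computability.AlgebraicComplexity.HomDepthFourReduction
import Literature.Computability.AlgebraicComplexity.ProjectedShiftedPartialsCaps
import Literature.Computability.AlgebraicComplexity.StandardFamilies
import Summits.ValiantsHypothesis.ValiantsHypothesis.Theorems.SPDChasmCeiling
import HarnessLib

/-!
# The Kumar–Saraf pipeline as a technique class, and its counting ceiling

File 1 of 2 (file 2 = `KSPipelinePer`); route `Depth4`, lens-4 «depth-reduction / chasm axis» of
the `decomp-valiant` workshop, generations 24–25 (OFFER O18), in support of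
`stmt-ValiantsHypothesis-11333` (`Depth4HomFour`).  Sorry-free; no Literature fact; ONE `Prop`
definition = the technique class `KSCertifies`; tree `KumarSaraf.pspDim`, `substVars`,
`GKKS.numSubsetsLE`, `KSCore01`, `KSCore`, `pspDim_subst_le` USED BY NAME.

The tree's Kumar–Saraf 2017 (`HomDepthFourSubstUpperBound`) reduces the homogeneous-`ΣΠΣΠ` lower
bound for `IMM` to a **combinatorial core** `KSCore01 K c n₀ ε`: every family `B` of at most
`T = ⌈n^{ε√n}⌉` sets of variables is answered by a `0/1`-substitution `ρ_{J,V}` (`J ↦ 1`, `V`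
kept, the rest `↦ 0`), an order `r`, a shift `m` and a set `L` of order-`r` operators such that
no `A ∈ B` with `> s` non-`J` variables survives and the projected shifted partials of
`ρ_{J,V}(IMM)` exceed `T · #{A ⊆ [2n/s+1] : |A| ≤ r} · ∑_{i ≤ rs} C(N, m+i)` (the per-gate
bound); the circuit side (`le_homDepthFourCircuitSize_immPoly_of_core01`) then gives `T ≤ size`.
* §1 isolates this shape as a **technique class** `KSCertifies f n s T` for an ARBITRARY target
  `f` and threshold `T` (`KSCore01` is literally the class at `f = IMM`, `ksCore01_iff`; the
  zero-restriction core `KSCore` lies inside it, `ksCertifies_of_ksCore`) and proves its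
  **soundness for every homogeneous target** (`le_homDepthFourCircuitSize_of_ksCertifies`).
* §2 proves the **counting ceiling**: whatever `J, V, r, m, L`, the measure of a polynomial of
  degree `≤ n` on `N ≥ 1` variables is at most `(if n ≤ r(s+1) then 1 else N^r)` times the
  per-gate bound (`pspDim_le_ceiling`; new ingredient: the inhomogeneous degree cap
  `pspDim_le_sum_choose_of_totalDegree_le` — homogeneity is lost under `J ↦ 1`), so NO target of
  degree `≤ n` admits a certificate at a threshold `T ≥ N^((n-1)/(s+1))` (`not_ksCertifies_of_le`).
SCOPE: the `0/1`-substitution + projected-shifted-partials pipeline in the tree's `KSCore01`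
currency ONLY — NOT covered: affine projections of partials (APP), lopsided / relative-rank
measures (LST), non-`0/1` substitutions, any post-processing other than the multilinear
projection.  NON-VACUITY: by citation only (Kumar–Saraf's `IMM` theorem is the `hcore` instance;
`KSCore01` is open in the tree).  References: M. Kumar, S. Saraf, SIAM J. Comput. 46 (2017)
336–387, §5.1, Lemmas 8.2, 8.9, Thm. 8.10; N. Kayal, R. Saptharishi, *A selection of lower bounds
for arithmetic circuits* (2014), §5 (the caps heuristic `min(#generators, #monomials)`).
-/

set_option linter.dupNamespace false

noncomputable section

open MvPolynomial Literature.Computability.AlgebraicComplexity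
open Literature.Computability.AlgebraicComplexity.KumarSaraf
open Literature.Computability.AlgebraicComplexity.GKKS
open Summit.ValiantsHypothesis.ValiantsHypothesis.Theorems.SPDChasmCeiling

namespace Summit.ValiantsHypothesis.ValiantsHypothesis.Theorems.KSPipelineCeiling

variable {K : Type} [Field K] {σ : Type} [Fintype σ] [DecidableEq σ]

/-! ### §1 The technique class and its soundness -/

/-- **Technique class** `KSCertifies f n s T`: the hypothesis `hcore` of the tree's
`le_homDepthFourCircuitSize_immPoly_of_core01` (Kumar–Saraf 2017, Thm. 8.10) with `IMM_{n^c,n}`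
replaced by an arbitrary target `f` and `⌈n^{ε√n}⌉` by an arbitrary threshold `T`: for every
family `B` of at most `T` sets of variables there are `J` (set to `1`), `V` (kept), an order `r`,
a shift `m` and a finite set `L` of words of length `r` such that no `A ∈ B` with more than `s`
non-`J` variables has them all in `V`, and
`T · #{A ⊆ [2n/s+1] : |A| ≤ r} · ∑_{i ≤ rs} C(N, m+i) < Φ_{L,m}(ρ_{J,V} f)`.  A DEFINITION of the
certificate shape (a local construction, assumed nowhere), not a named fact.
[cite: KumarSaraf2017, Thm. 8.10 (hypothesis `hcore`)] -/
def KSCertifies (f : MvPolynomial σ K) (n s T : ℕ) : Prop :=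
  ∀ B : Finset (Finset σ), B.card ≤ T →
    ∃ (J V : Finset σ) (r m : ℕ) (L : Finset (List σ)),
      (∀ l ∈ L, l.length = r) ∧ (∀ A ∈ B, s < (A \ J).card → ¬ (A \ J ⊆ V)) ∧
      T * (numSubsetsLE (2 * n / s + 1) r *
            ∑ i ∈ Finset.range (r * s + 1), (Fintype.card σ).choose (m + i)) <
        pspDim (fun l : L => (l : List σ)) m (substVars J V f)

/-- The tree's combinatorial core `KSCore01` IS the class at `f = IMM_{n^c,n}`, `T = ⌈n^{ε√n}⌉`,
literally. [cite: KumarSaraf2017, Lemma 8.2 and Lemma 8.9] -/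
theorem ksCore01_iff (K : Type) [Field K] (c n₀ : ℕ) (ε : ℝ) :
    KSCore01 K c n₀ ε ↔ ∀ n : ℕ, n₀ ≤ n → ∃ s : ℕ, 1 ≤ s ∧
      KSCertifies (immPoly (n ^ c) n K) n s ⌈(n : ℝ) ^ (ε * Real.sqrt n)⌉₊ :=
  Iff.rfl

omit [Fintype σ] in
/-- Zero-restrictions are the `0/1`-substitutions with `J = ∅`. [folklore] -/
theorem substVars_empty (V : Finset σ) (f : MvPolynomial σ K) :
    substVars ∅ V f = restrictVars V f := by
  simp [substVars, restrictVars]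

/-- A certificate in the zero-restriction shape of the tree's `KSCore` is one of the class
(`J = ∅`; answer only the large sets of `B`). [cite: KumarSaraf2017, Lemma 8.2 and Lemma 8.9] -/
theorem ksCertifies_of_zeroRestriction {f : MvPolynomial σ K} {n s T : ℕ}
    (h : ∀ B : Finset (Finset σ), B.card ≤ T → (∀ A ∈ B, s < A.card) →
      ∃ (V : Finset σ) (r m : ℕ) (L : Finset (List σ)),
        (∀ l ∈ L, l.length = r) ∧ (∀ A ∈ B, ¬ A ⊆ V) ∧
        T * (numSubsetsLE (2 * n / s + 1) r *
              ∑ i ∈ Finset.range (r * s + 1), (Fintype.card σ).choose (m + i)) <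
          pspDim (fun l : L => (l : List σ)) m (restrictVars V f)) :
    KSCertifies f n s T := by
  intro B hB
  obtain ⟨V, r, m, L, hL, hV, hbig⟩ := h (B.filter fun A => s < A.card)
    ((Finset.card_filter_le _ _).trans hB) (fun A hA => (Finset.mem_filter.1 hA).2)
  refine ⟨∅, V, r, m, L, hL, fun A hA hs hsub => ?_, ?_⟩
  · rw [Finset.sdiff_empty] at hs hsub
    exact hV A (Finset.mem_filter.2 ⟨hA, hs⟩) hsub
  · rwa [substVars_empty]

/-- Hence the zero-restriction core `KSCore` puts `IMM_{n^c,n}` in the class (`n ≥ n₀`).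
[cite: KumarSaraf2017, Lemma 8.2 and Lemma 8.9] -/
theorem ksCertifies_of_ksCore {K : Type} [Field K] {c n₀ : ℕ} {ε : ℝ} (h : KSCore K c n₀ ε)
    {n : ℕ} (hn : n₀ ≤ n) :
    ∃ s : ℕ, 1 ≤ s ∧ KSCertifies (immPoly (n ^ c) n K) n s ⌈(n : ℝ) ^ (ε * Real.sqrt n)⌉₊ := by
  obtain ⟨s, hs, hcore⟩ := h n hn
  exact ⟨s, hs, ksCertifies_of_zeroRestriction hcore⟩

/-- **Soundness of the class for EVERY homogeneous target** (circuit side of KS17 Thm. 8.10,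
the tree's proof verbatim with `IMM ↦ f`): a certificate at threshold `T` for `f` homogeneous of
degree `n ≥ 2`, `s ≥ 1`, gives `T ≤ size`. [cite: KumarSaraf2017, Thm. 8.10 (proof)] -/
theorem le_homDepthFourCircuitSize_of_ksCertifies {f : MvPolynomial σ K} {n s T : ℕ}
    (hf : f.IsHomogeneous n) (hn : 2 ≤ n) (hs : 1 ≤ s) (h : KSCertifies f n s T) :
    (T : ℕ∞) ≤ homDepthFourCircuitSize f := by
  classical
  refine le_iInf₂ fun P hP => ?_
  obtain ⟨hc, h4, hh⟩ := hP
  rw [ENat.coe_le_coe]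
  by_contra hlt
  push Not at hlt
  set B : Finset (Finset σ) := P.monoExps.image Finsupp.support with hB
  have hBcard : B.card ≤ T :=
    calc B.card ≤ P.monoExps.card := Finset.card_image_le
      _ ≤ P.size := P.card_monoExps_le
      _ ≤ _ := hlt.le
  obtain ⟨J, V, r, m, L, hL, hV, hbig⟩ := h B hBcard
  have hevent : ∀ e ∈ P.monoExps, e.support \ J ⊆ V → (e.support \ J).card ≤ s := by
    intro e he hsub
    by_contra hgt
    push Not at hgt
    exact hV e.support (Finset.mem_image.2 ⟨e, he, rfl⟩) hgt hsub
  have hup := pspDim_subst_le hc h4 hh hf hn J V hs hevent (fun l : L => (l : List σ)) r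
    (fun l => hL l l.2) m
  have := hbig.trans_le hup
  exact absurd (Nat.lt_of_mul_lt_mul_right this) (not_lt.2 hlt.le)

/-! ### §2 The counting ceiling -/
omit [DecidableEq σ] in
/-- **Degree cap for the projected measure, inhomogeneous form**: for `f` of total degree `≤ d`,
operators of order `r` and shift `m`, every generator `σ(x^S · ∂_L f)` is a linear combination of
multilinear monomials `x^T` with `m ≤ |T| ≤ m + (d - r)`, hence
`Φ_{L,m}(f) ≤ ∑_{i=0}^{d-r} C(N, m+i)`. [cite: KumarSaraf2017, §5.1] -/
theorem pspDim_le_sum_choose_of_totalDegree_le {ι : Type} (Ls : ι → List σ) (r : ℕ)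
    (hLs : ∀ i, (Ls i).length = r) (m : ℕ) {f : MvPolynomial σ K} {d : ℕ}
    (hf : f.totalDegree ≤ d) :
    pspDim Ls m f ≤ ∑ i ∈ Finset.range (d - r + 1), (Fintype.card σ).choose (m + i) := by
  classical
  set F : Finset (MvPolynomial σ K) :=
    (Finset.range (d - r + 1)).biUnion fun i =>
      (Finset.powersetCard (m + i) (Finset.univ : Finset σ)).image
        fun T => monomial (chi T) (1 : K)
    with hF
  have hgen : ∀ p, pspGen Ls m f p ∈ Submodule.span K (F : Set (MvPolynomial σ K)) := by
    rintro ⟨i, S, hS⟩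
    set g : MvPolynomial σ K := monomial (chi S) (1 : K) * iterPderiv (Ls i) f with hg
    change mlProj K g ∈ _
    have hml : mlProj K g = ∑ β ∈ g.support.filter IsML, monomial β (coeff β g) := rfl
    rw [hml]
    refine Submodule.sum_mem _ fun β hβ => ?_
    obtain ⟨hβs, hβml⟩ := Finset.mem_filter.1 hβ
    have hcoeff : coeff β g ≠ 0 := mem_support_iff.1 hβs
    rw [hg, coeff_monomial_mul'] at hcoeff
    have hle : chi S ≤ β := by
      by_contra hne
      exact hcoeff (if_neg hne)
    rw [if_pos hle, one_mul] at hcoeff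
    have hγ : β - chi S ∈ (iterPderiv (Ls i) f).support := mem_support_iff.2 hcoeff
    have hne0 : iterPderiv (K := K) (Ls i) f ≠ 0 := fun h0 => by
      rw [h0, support_zero] at hγ
      exact Finset.notMem_empty _ hγ
    have hγdeg : (β - chi S).degree ≤ d - r := by
      have h1 := degree_le_totalDegree hγ
      have h2 := totalDegree_iterPderiv_add_le (Ls i) f hne0
      rw [hLs i] at h2
      omega
    have hβeq : β = chi S + (β - chi S) := (add_tsub_cancel_of_le hle).symm
    have hβdeg : β.degree = m + (β - chi S).degree := by
      conv_lhs => rw [hβeq]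
      rw [map_add, degree_chi, hS]
    have hmono : monomial β (coeff β g) = coeff β g • monomial (chi β.support) (1 : K) := by
      rw [hβml.chi_support, smul_monomial, smul_eq_mul, mul_one]
    rw [hmono]
    refine Submodule.smul_mem _ _ (Submodule.subset_span ?_)
    rw [Finset.mem_coe, hF, Finset.mem_biUnion]
    refine ⟨(β - chi S).degree, Finset.mem_range.2 (by omega), ?_⟩
    rw [Finset.mem_image]
    refine ⟨β.support, ?_, rfl⟩
    rw [Finset.mem_powersetCard]
    exact ⟨Finset.subset_univ _, by rw [← hβml.degree_eq_card_support, hβdeg]⟩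
  have hle : pspSpan Ls m f ≤ Submodule.span K (F : Set (MvPolynomial σ K)) :=
    Submodule.span_le.2 (by rintro _ ⟨p, rfl⟩; exact hgen p)
  haveI : Module.Finite K (Submodule.span K (F : Set (MvPolynomial σ K))) :=
    Module.Finite.span_of_finite K F.finite_toSet
  calc pspDim Ls m f
      ≤ Module.finrank K (Submodule.span K (F : Set (MvPolynomial σ K))) :=
        Submodule.finrank_mono hle
    _ ≤ F.card := finrank_span_finset_le_card F
    _ ≤ ∑ i ∈ Finset.range (d - r + 1),
          ((Finset.powersetCard (m + i) (Finset.univ : Finset σ)).image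
            fun T => monomial (chi T) (1 : K)).card := Finset.card_biUnion_le
    _ ≤ ∑ i ∈ Finset.range (d - r + 1), (Fintype.card σ).choose (m + i) :=
        Finset.sum_le_sum fun i _ => Finset.card_image_le.trans
          (le_of_eq (by rw [Finset.card_powersetCard, Finset.card_univ]))

omit [DecidableEq σ] in
/-- A finite set of words of a common length `r` has at most `N^r` members. [folklore] -/
theorem card_le_pow_of_length_eq (L : Finset (List σ)) {r : ℕ} (hL : ∀ l ∈ L, l.length = r) :
    L.card ≤ Fintype.card σ ^ r := by
  classical
  have hinj : Function.Injective fun l : L => (⟨(l : List σ), hL l l.2⟩ : List.Vector σ r) := by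
    intro a b hab
    exact Subtype.ext (by simpa using congrArg List.Vector.toList hab)
  calc L.card = Fintype.card L := (Fintype.card_coe L).symm
    _ ≤ Fintype.card (List.Vector σ r) := Fintype.card_le_of_injective _ hinj
    _ = Fintype.card σ ^ r := card_vector r

omit [DecidableEq σ] in
/-- **Generator cap in the `KS` currency**: `Φ_{L,m}(g) ≤ N^r · C(N, m)` for operators drawn from a
finite set of words of length `r`. [cite: KumarSaraf2017, §5.1] -/
theorem pspDim_le_pow_mul_choose (L : Finset (List σ)) {r : ℕ} (hL : ∀ l ∈ L, l.length = r)
    (m : ℕ) (g : MvPolynomial σ K) :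
    pspDim (fun l : L => (l : List σ)) m g ≤ Fintype.card σ ^ r * (Fintype.card σ).choose m := by
  classical
  calc pspDim (fun l : L => (l : List σ)) m g ≤ Fintype.card L * (Fintype.card σ).choose m :=
        pspDim_le_card_mul_choose _ m g
    _ ≤ Fintype.card σ ^ r * (Fintype.card σ).choose m := by
        rw [Fintype.card_coe]
        exact Nat.mul_le_mul_right _ (card_le_pow_of_length_eq L hL)

omit [DecidableEq σ] in
/-- One binomial is below the per-gate bound (the `i = 0` term; `#{A} ≥ 1`). [folklore] -/
theorem choose_le_gate (n s r m : ℕ) :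
    (Fintype.card σ).choose m ≤ numSubsetsLE (2 * n / s + 1) r *
      ∑ i ∈ Finset.range (r * s + 1), (Fintype.card σ).choose (m + i) := by
  calc (Fintype.card σ).choose m = 1 * (Fintype.card σ).choose (m + 0) := by
        rw [Nat.one_mul, Nat.add_zero]
    _ ≤ numSubsetsLE (2 * n / s + 1) r *
          ∑ i ∈ Finset.range (r * s + 1), (Fintype.card σ).choose (m + i) :=
        Nat.mul_le_mul (numSubsetsLE_pos _ _)
          (Finset.single_le_sum (f := fun i => (Fintype.card σ).choose (m + i))
            (fun _ _ => Nat.zero_le _) (Finset.mem_range.2 (Nat.succ_pos _)))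

omit [DecidableEq σ] in
/-- A shorter partial sum of the binomials is below the per-gate bound. [folklore] -/
theorem sum_choose_le_gate (n s r m : ℕ) {e : ℕ} (he : e ≤ r * s + 1) :
    ∑ i ∈ Finset.range e, (Fintype.card σ).choose (m + i) ≤ numSubsetsLE (2 * n / s + 1) r *
      ∑ i ∈ Finset.range (r * s + 1), (Fintype.card σ).choose (m + i) := by
  calc ∑ i ∈ Finset.range e, (Fintype.card σ).choose (m + i)
      = 1 * ∑ i ∈ Finset.range e, (Fintype.card σ).choose (m + i) := (Nat.one_mul _).symm
    _ ≤ _ := Nat.mul_le_mul (numSubsetsLE_pos _ _)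
        (Finset.sum_le_sum_of_subset (Finset.range_subset_range.2 he))

omit [DecidableEq σ] in
/-- **THE COUNTING CEILING**: for every `g` of degree `≤ n`, finite set `L` of order-`r` operators
and shift `m`: `Φ_{L,m}(g) ≤ (if n ≤ r(s+1) then 1 else N^r) · #{A} · ∑_{i ≤ rs} C(N, m+i)` — for
`r ≥ n/(s+1)` the degree cap sits below ONE gate's bound, else the generator cap gives `N^r`.
[cite: KumarSaraf2017, §5.1] -/
theorem pspDim_le_ceiling (L : Finset (List σ)) {r : ℕ} (hL : ∀ l ∈ L, l.length = r)
    (m n s : ℕ) {g : MvPolynomial σ K} (hg : g.totalDegree ≤ n) :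
    pspDim (fun l : L => (l : List σ)) m g ≤
      (if n ≤ r * (s + 1) then 1 else Fintype.card σ ^ r) *
        (numSubsetsLE (2 * n / s + 1) r *
          ∑ i ∈ Finset.range (r * s + 1), (Fintype.card σ).choose (m + i)) := by
  split_ifs with h
  · rw [Nat.one_mul]
    refine (pspDim_le_sum_choose_of_totalDegree_le (fun l : L => (l : List σ)) r
      (fun l => hL l l.2) m hg).trans (sum_choose_le_gate n s r m ?_)
    have hrs : r * (s + 1) = r * s + r := by ring
    omega
  · exact (pspDim_le_pow_mul_choose L hL m g).trans
      (Nat.mul_le_mul_left _ (choose_le_gate n s r m))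

/-- **No certificate above the counting ceiling** — for ANY target `f` of degree `≤ n` on `N ≥ 1`
variables (`per`, `det`, `IMM` alike; `ρ_{J,V}` only lowers degrees): `N^((n-1)/(s+1)) ≤ T`
excludes `KSCertifies f n s T` (adversary: the empty family). [cite: KumarSaraf2017, §5.1] -/
theorem not_ksCertifies_of_le {f : MvPolynomial σ K} {n s T : ℕ} (hf : f.totalDegree ≤ n)
    (hσ : 1 ≤ Fintype.card σ) (hT : Fintype.card σ ^ ((n - 1) / (s + 1)) ≤ T) :
    ¬ KSCertifies f n s T := by
  intro h
  obtain ⟨J, V, r, m, L, hL, -, hbig⟩ := h ∅ (by simp)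
  have hdeg : (substVars J V f).totalDegree ≤ n := (totalDegree_substVars_le J V f).trans hf
  have hlt := hbig.trans_le (pspDim_le_ceiling L hL m n s hdeg)
  have hT' : T < (if n ≤ r * (s + 1) then 1 else Fintype.card σ ^ r) :=
    Nat.lt_of_mul_lt_mul_right hlt
  split_ifs at hT' with h
  · have : 1 ≤ T := (Nat.one_le_pow _ _ hσ).trans hT
    omega
  · have hr : r ≤ (n - 1) / (s + 1) := by
      rw [Nat.le_div_iff_mul_le (by omega : 0 < s + 1)]
      push Not at h
      omega
    exact absurd (hT.trans_lt (hT'.trans_le (Nat.pow_le_pow_right hσ hr))) (lt_irrefl _)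

end Summit.ValiantsHypothesis.ValiantsHypothesis.Theorems.KSPipelineCeiling

end
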